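import Literature.Barriers.CriticalPhenomena.TimarNonunimodularLevels
import HarnessLib

/-!
# Heights with long edges on quasi-transitive nonunimodular graphs — the level structure behind
# the quasi-transitive form of Timár 2006, Thm. 4.3, PROVED

Barrier catalogue `Literature/Barriers/CriticalPhenomena/`; a brick of the programme behind the
named fact `Timar2006_atMostOneCriticalCluster` (`SubexponentialGrowthZdUniqueness.lean`), the
quasi-transitive form — quoted by Hutchcroft (2016, §2) and Lyons–Peres (2016, §8.8 notes) — of
Á. Timár, *Percolation on nonunimodular transitive graphs*, Ann. Probab. 34 (2006) 2344–2364,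
Cor. 5.7. The transitive Thm. 4.3 (no infinite light clusters at `p_c`) is proved in the tree
(`TimarNoLightClustersFirstMoment.lean`); its proof rests on the following structure of a
connected, locally finite, TRANSITIVE nonunimodular graph with weights `w = autWeight G o`
(`TimarLevelGrid.lean`): with `Δ := ` the least weight ratio along an edge,
(I) every edge changes the weight by a factor in `[Δ, Δ⁻¹]`, and (II) *long edges everywhere*:
every vertex `x` has a neighbour of weight exactly `Δ · w(x)` (Timár 2006, proof of Thm. 4.3,
p. 2354: "let `ℓ_1` be the lowest level that contains a vertex adjacent (in `G`) to `o`. Let the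
edges between `o` and `ℓ_1` be called *long edges*"; transitivity moves them to every vertex).

On a QUASI-TRANSITIVE nonunimodular graph (II) fails for the weights `w` themselves: a vertex
may have all its neighbours strictly above it (e.g. the two pendant leaves attached to every
vertex of the grandparent graph have half the weight of their base). This file PROVES that the
structure (I)–(II) is nevertheless always available after an `Aut(G)`-invariant change of gauge:

* `HeightSystem G o` — the data of an `Aut(G)`-invariant gauge `κ : V → [c, C] ⊂ (0, ∞)`,
  `κ(o) = 1`, and a ratio `Δ ∈ (0, 1)` such that the *heights* `h(x) := κ(x) · w(x)` (`h(o) = 1`)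
  satisfy (I) `Δ h(x) ≤ h(y)` along every edge and (II) every vertex has a neighbour of height
  exactly `Δ h(x)`; heights keep
  the cocycle `h(γx) h(y) = h(γy) h(x)` of the weights (`HeightSystem.height_map_mul`) and the
  same heavy/light sets (`HeightSystem.tsum_indicator_height_eq_top_iff`);
* `exists_heightSystem` — **on a connected, locally finite, quasi-transitive, nonunimodular
  graph a height system exists.** Proof: the tropical (min-plus) eigenvector of the finite orbit
  digraph with arc weights `log (w(y)/w(x))`. Concretely, with `L = log w` and `N` the size of a
  finite set `S₀` of vertices met by every orbit: `μ :=` the least mean log-drop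
  `(L(y) − L(x))/n` over walks of length `1 ≤ n ≤ N` from `S₀` returning to the orbit of their
  start (`y ∈ Aut(G) x`); by a pigeonhole-and-transport induction EVERY returning walk of length
  `m` has `L(y) − L(x) ≥ μ m` (`returning_bound`), and `μ < 0` by nonunimodularity; then
  `φ(x) := min {L(z) − L(x) − μ n : n ≤ N', z` in the orbit of a minimiser`}` is an
  `Aut(G)`-invariant, finitely-valued potential with `φ(x) ≤ L(y) − L(x) − μ + φ(y)` along
  edges and equality along some edge at every vertex; `κ := e^{φ − φ(o)}`, `Δ := e^μ`.
  This is the standard construction of an eigenvector of an irreducible min-plus matrix from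
  shortest walks to a critical cycle; it is not in Timár's paper, whose §4 is written for
  transitive graphs, and is the one new ingredient of the quasi-transitive extension of the level
  grid ("no printed source carries out the extension", scope note of
  `TimarCriticalNonunimodular.lean`; Tang 2019, §4, on Timár's results in the quasi-transitive
  setting: "the proof can be easily adapted").

Also: `StepReach G n x y` (walks of length exactly `n` as vertex sequences, with transport,
concatenation, segments and the orbit pigeonhole `exists_orbit_repeat`) and `logWeight`.

## References

* Á. Timár, Ann. Probab. 34 (2006) 2344–2364 (arXiv:math/0702875), §2 (weights, levels), §4
  (proof of Thm. 4.3: `ℓ_1`, long edges, `Δ`), §5 (automorphisms multiply weights by a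
  constant). [Timar2006]
* T. Hutchcroft, C. R. Math. Acad. Sci. Paris 354 (2016) 944–947, §2 (Timár's theorem quoted for
  quasi-transitive graphs). [Hutchcroft2016]
* P. Tang, *Heavy Bernoulli-percolation clusters are indistinguishable*, Ann. Probab. 47 (2019),
  §4 (quasi-transitive nonunimodular setting; Prop. 4.6 "can be easily adapted"). [Tang2019]
* R. Lyons, Y. Peres, *Probability on Trees and Networks*, CUP 2016, §8.2, Thm. 8.10 (the
  weights `μ_x` and their cocycle). [LyonsPeres2016]
-/

noncomputable section

namespace Literature.Barriers.CriticalPhenomena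

open scoped _root_.ENNReal

variable {V : Type*}

/-! ### Walks of length exactly `n` as vertex sequences -/

/-- `StepReach G n x y`: a walk of length exactly `n` from `x` to `y`, recorded as a vertex
sequence `f 0 = x, f 1, …, f n = y` of consecutive neighbours. [folklore] -/
def StepReach (G : SimpleGraph V) (n : ℕ) (x y : V) : Prop :=
  ∃ f : ℕ → V, f 0 = x ∧ f n = y ∧ ∀ i < n, G.Adj (f i) (f (i + 1))

section StepReach

variable {G : SimpleGraph V}

/-- The trivial walk. [folklore] -/
theorem stepReach_zero (G : SimpleGraph V) (x : V) : StepReach G 0 x x :=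
  ⟨fun _ => x, rfl, rfl, fun i hi => absurd hi (Nat.not_lt_zero i)⟩

/-- A walk of length `0` joins a vertex to itself. [folklore] -/
theorem StepReach.eq_of_zero {x y : V} (h : StepReach G 0 x y) : x = y := by
  obtain ⟨f, h0, hn, -⟩ := h
  rw [← h0, ← hn]

/-- Prepending an edge. [folklore] -/
theorem StepReach.cons {n : ℕ} {x z y : V} (hxz : G.Adj x z) (h : StepReach G n z y) :
    StepReach G (n + 1) x y := by
  obtain ⟨f, h0, hn, hf⟩ := h
  refine ⟨fun i => if i = 0 then x else f (i - 1), if_pos rfl, ?_, ?_⟩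
  · show (if n + 1 = 0 then x else f (n + 1 - 1)) = y
    rw [if_neg (Nat.succ_ne_zero n), Nat.add_sub_cancel, hn]
  · intro i hi
    rcases i with _ | i
    · show G.Adj (if 0 = 0 then x else f (0 - 1)) (if 0 + 1 = 0 then x else f (0 + 1 - 1))
      rw [if_pos rfl, if_neg (Nat.succ_ne_zero 0), Nat.zero_add, Nat.sub_self, h0]
      exact hxz
    · show G.Adj (if i + 1 = 0 then x else f (i + 1 - 1))
        (if i + 1 + 1 = 0 then x else f (i + 1 + 1 - 1))
      rw [if_neg (Nat.succ_ne_zero i), if_neg (Nat.succ_ne_zero _), Nat.add_sub_cancel,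
        Nat.add_sub_cancel]
      exact hf i (by omega)

/-- Removing the first edge. [folklore] -/
theorem StepReach.uncons {n : ℕ} {x y : V} (h : StepReach G (n + 1) x y) :
    ∃ z : V, G.Adj x z ∧ StepReach G n z y := by
  obtain ⟨f, h0, hn, hf⟩ := h
  refine ⟨f 1, ?_, fun i => f (i + 1), rfl, hn, fun i hi => hf (i + 1) (by omega)⟩
  have := hf 0 (Nat.succ_pos n)
  rwa [h0] at this

/-- The segment `f a, …, f b` of a vertex sequence of consecutive neighbours. [folklore] -/
theorem stepReach_segment {m : ℕ} {f : ℕ → V} (hf : ∀ i < m, G.Adj (f i) (f (i + 1))) {a b : ℕ}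
    (hab : a ≤ b) (hbm : b ≤ m) : StepReach G (b - a) (f a) (f b) := by
  refine ⟨fun i => f (a + i), ?_, ?_, fun i hi => ?_⟩
  · show f (a + 0) = f a
    rw [Nat.add_zero]
  · show f (a + (b - a)) = f b
    rw [Nat.add_sub_cancel' hab]
  · exact hf (a + i) (by omega)

/-- Concatenation. [folklore] -/
theorem StepReach.append {m n : ℕ} {x y z : V} (h₁ : StepReach G m x y) (h₂ : StepReach G n y z) :
    StepReach G (m + n) x z := by
  obtain ⟨f, hf0, hfm, hf⟩ := h₁
  obtain ⟨g, hg0, hgn, hg⟩ := h₂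
  refine ⟨fun i => if i ≤ m then f i else g (i - m), ?_, ?_, ?_⟩
  · show (if 0 ≤ m then f 0 else g (0 - m)) = x
    rw [if_pos (Nat.zero_le m), hf0]
  · show (if m + n ≤ m then f (m + n) else g (m + n - m)) = z
    rcases Nat.eq_zero_or_pos n with rfl | hn
    · rw [if_pos (by omega), Nat.add_zero, hfm, ← hg0, hgn]
    · rw [if_neg (by omega), Nat.add_sub_cancel_left, hgn]
  · intro i hi
    show G.Adj (if i ≤ m then f i else g (i - m)) (if i + 1 ≤ m then f (i + 1) else g (i + 1 - m))
    rcases lt_trichotomy i m with him | rfl | him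
    · rw [if_pos him.le, if_pos (by omega)]
      exact hf i him
    · rw [if_pos le_rfl, if_neg (by omega), hfm, ← hg0, Nat.add_sub_cancel_left]
      exact hg 0 (by omega)
    · rw [if_neg (by omega), if_neg (by omega), show i + 1 - m = (i - m) + 1 by omega]
      exact hg (i - m) (by omega)

/-- Transport by an automorphism. [folklore] -/
theorem StepReach.map {n : ℕ} {x y : V} (γ : G ≃g G) (h : StepReach G n x y) :
    StepReach G n (γ x) (γ y) := by
  obtain ⟨f, h0, hn, hf⟩ := h
  exact ⟨fun i => γ (f i), by show γ (f 0) = γ x; rw [h0], by show γ (f n) = γ y; rw [hn],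
    fun i hi => (γ.map_rel_iff').2 (hf i hi)⟩

/-- A walk of the graph gives a vertex sequence of its length. [folklore] -/
theorem stepReach_of_walk {x y : V} (w : G.Walk x y) : StepReach G w.length x y :=
  ⟨fun i => w.getVert i, w.getVert_zero, w.getVert_length, fun _ hi => w.adj_getVert_succ hi⟩

/-- A vertex sequence gives a walk of the graph of the same length. [folklore] -/
theorem StepReach.exists_walk {n : ℕ} {x y : V} (h : StepReach G n x y) :
    ∃ w : G.Walk x y, w.length = n := by
  induction n generalizing x with
  | zero =>
    cases h.eq_of_zero
    exact ⟨SimpleGraph.Walk.nil, rfl⟩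
  | succ n ih =>
    obtain ⟨z, hxz, hz⟩ := h.uncons
    obtain ⟨w, hw⟩ := ih hz
    exact ⟨SimpleGraph.Walk.cons hxz w, by rw [SimpleGraph.Walk.length_cons, hw]⟩

/-- The far end of an `n`-step walk lies in the ball of radius `n`. [folklore] -/
theorem StepReach.mem_graphBall {n : ℕ} {x y : V} (h : StepReach G n x y) : y ∈ graphBall G x n := by
  obtain ⟨w, hw⟩ := h.exists_walk
  exact ⟨w, hw.le⟩

/-- On a connected graph any two vertices are joined by a walk of some length. [folklore] -/
theorem exists_stepReach_of_connected (hconn : G.Connected) (x y : V) : ∃ n, StepReach G n x y := by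
  obtain ⟨w⟩ := hconn.preconnected x y
  exact ⟨w.length, stepReach_of_walk w⟩

/-- **Orbit pigeonhole**: among the first `|S₀| + 1` vertices of any vertex sequence two lie in a
common `Aut(G)`-orbit, `S₀` being a finite set met by every orbit (quasi-transitivity).
[folklore] -/
theorem exists_orbit_repeat (S₀ : Finset V) (hS₀ : ∀ v : V, ∃ γ : G ≃g G, γ v ∈ S₀) (f : ℕ → V) :
    ∃ i j : ℕ, i < j ∧ j ≤ S₀.card ∧ f j ∈ autOrbit G (f i) := by
  classical
  choose γ hγ using hS₀
  set rep : ℕ → V := fun i => γ (f i) (f i) with hrep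
  have hmaps : Set.MapsTo rep ↑(Finset.range (S₀.card + 1)) ↑S₀ := fun i _ => hγ (f i)
  have hcard : S₀.card < (Finset.range (S₀.card + 1)).card := by simp
  obtain ⟨a, ha, b, hb, hab, heq⟩ := Finset.exists_ne_map_eq_of_card_lt_of_maps_to hcard hmaps
  rw [Finset.mem_range] at ha hb
  -- same representative ⇒ same orbit
  have horb : ∀ {a b : ℕ}, rep a = rep b → f b ∈ autOrbit G (f a) := by
    intro a b h
    refine ⟨(γ (f a)).trans (γ (f b)).symm, ?_⟩
    show (γ (f b)).symm (γ (f a) (f a)) = f b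
    have h' : γ (f a) (f a) = γ (f b) (f b) := h
    rw [h', RelIso.symm_apply_apply]
  rcases lt_or_gt_of_ne hab with h | h
  · exact ⟨a, b, h, by omega, horb heq⟩
  · exact ⟨b, a, h, by omega, horb heq.symm⟩

end StepReach

/-! ### Orbits: closure facts -/

section Orbit

variable {G : SimpleGraph V}

/-- Orbits are transitive. [folklore] -/
theorem mem_autOrbit_trans {x y z : V} (hxy : y ∈ autOrbit G x) (hyz : z ∈ autOrbit G y) :
    z ∈ autOrbit G x := by
  obtain ⟨γ, rfl⟩ := hxy
  obtain ⟨δ, rfl⟩ := hyz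
  exact ⟨γ.trans δ, rfl⟩

/-- Automorphisms preserve orbits. [folklore] -/
theorem map_mem_autOrbit_iff (γ : G ≃g G) {x z : V} : γ z ∈ autOrbit G x ↔ z ∈ autOrbit G x := by
  constructor
  · rintro ⟨δ, hδ⟩
    exact ⟨δ.trans γ.symm, show γ.symm (δ x) = z by rw [hδ, γ.symm_apply_apply]⟩
  · rintro ⟨δ, rfl⟩
    exact ⟨δ.trans γ, rfl⟩

/-- Automorphisms map orbits to orbits (base moved). [folklore] -/
theorem map_mem_autOrbit_map {x y : V} (δ : G ≃g G) (hy : y ∈ autOrbit G x) :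
    δ y ∈ autOrbit G (δ x) := by
  obtain ⟨γ, rfl⟩ := hy
  exact ⟨δ.symm.trans (γ.trans δ), show δ (γ (δ.symm (δ x))) = δ (γ x) by
    rw [δ.symm_apply_apply]⟩

end Orbit

/-! ### Logarithmic weights -/

/-- `L(x) := log w(x)`, the logarithm of the weight `w = autWeight G o` (a real number: the
weights lie in `(0, ∞)` on a connected locally finite graph). [cite: Timar2006, §5 (log_Δ w(x))] -/
def logWeight (G : SimpleGraph V) (o x : V) : ℝ :=
  Real.log (autWeight G o x).toReal

section LogWeight

variable (G : SimpleGraph V) [G.LocallyFinite]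

/-- `w(x) ∈ (0, ∞)` as a real number. [folklore] -/
theorem autWeight_toReal_pos (hconn : G.Connected) (o x : V) : 0 < (autWeight G o x).toReal :=
  ENNReal.toReal_pos (autWeight_ne_zero G hconn o x) (autWeight_ne_top G hconn o x)

/-- `w = e^L`. [folklore] -/
theorem autWeight_eq_ofReal_exp_logWeight (hconn : G.Connected) (o x : V) :
    autWeight G o x = ENNReal.ofReal (Real.exp (logWeight G o x)) := by
  rw [logWeight, Real.exp_log (autWeight_toReal_pos G hconn o x),
    ENNReal.ofReal_toReal (autWeight_ne_top G hconn o x)]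

/-- **Automorphisms shift all log-weights by one constant**: `L(γx) − L(x) = L(γy) − L(y)`
(Timár 2006, §5: "any automorphism … acts on the weights … by multiplying them with a
constant"). [cite: Timar2006, §5 (automorphisms act on weights by a constant factor)] -/
theorem logWeight_map_sub (hconn : G.Connected) (γ : G ≃g G) (o x y : V) :
    logWeight G o (γ x) - logWeight G o x = logWeight G o (γ y) - logWeight G o y := by
  have h := autWeight_map_mul G hconn γ o x y
  have h' : (autWeight G o (γ x)).toReal * (autWeight G o y).toReal =
      (autWeight G o (γ y)).toReal * (autWeight G o x).toReal := by
    rw [← ENNReal.toReal_mul, ← ENNReal.toReal_mul, h]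
  have hl := congrArg Real.log h'
  rw [Real.log_mul (autWeight_toReal_pos G hconn o _).ne' (autWeight_toReal_pos G hconn o _).ne',
    Real.log_mul (autWeight_toReal_pos G hconn o _).ne' (autWeight_toReal_pos G hconn o _).ne'] at hl
  simp only [logWeight]
  linarith

/-- `L` is strictly monotone in `w`. [folklore] -/
theorem logWeight_lt_logWeight_iff (hconn : G.Connected) (o x y : V) :
    logWeight G o y < logWeight G o x ↔ autWeight G o y < autWeight G o x := by
  rw [logWeight, logWeight, Real.log_lt_log_iff (autWeight_toReal_pos G hconn o y)
    (autWeight_toReal_pos G hconn o x),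
    ENNReal.toReal_lt_toReal (autWeight_ne_top G hconn o y) (autWeight_ne_top G hconn o x)]

end LogWeight

/-! ### Height systems -/

/-- A **height system** on `G` (weights based at `o`): an `Aut(G)`-invariant gauge
`κ : V → [lower, upper] ⊂ (0, ∞)` and a ratio `Δ ∈ (0, 1)` such that the heights
`h(x) = κ(x) w(x)` drop by at most the factor `Δ` along every edge and every vertex has a *long
edge*, to a neighbour of height exactly `Δ h(x)` — the structure "`ℓ_1` is the lowest level
adjacent to `o` … long edges" of the proof of Thm. 4.3 (there for the weights of a transitive
graph, `κ = 1`). [cite: Timar2006, §4 (proof of Thm. 4.3: ℓ_1, long edges, Δ)] -/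
structure HeightSystem (G : SimpleGraph V) (o : V) where
  /-- the gauge `κ` -/
  gauge : V → ℝ≥0∞
  /-- the ratio `Δ` of a long edge -/
  ratio : ℝ≥0∞
  /-- a positive lower bound for the gauge -/
  lower : ℝ≥0∞
  /-- a finite upper bound for the gauge -/
  upper : ℝ≥0∞
  gauge_map : ∀ (γ : G ≃g G) (x : V), gauge (γ x) = gauge x
  gauge_base : gauge o = 1
  lower_ne_zero : lower ≠ 0
  upper_ne_top : upper ≠ ⊤
  lower_le : ∀ x : V, lower ≤ gauge x
  le_upper : ∀ x : V, gauge x ≤ upper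
  ratio_ne_zero : ratio ≠ 0
  ratio_lt_one : ratio < 1
  ratio_mul_le : ∀ ⦃x y : V⦄, G.Adj x y →
    ratio * (gauge x * autWeight G o x) ≤ gauge y * autWeight G o y
  exists_adj_eq : ∀ x : V, ∃ y : V, G.Adj x y ∧
    gauge y * autWeight G o y = ratio * (gauge x * autWeight G o x)

namespace HeightSystem

variable {G : SimpleGraph V} {o : V}

/-- The **height** `h(x) = κ(x) · w(x)`. [cite: Timar2006, §4 (proof of Thm. 4.3: weights and levels)] -/
def height (η : HeightSystem G o) (x : V) : ℝ≥0∞ := η.gauge x * autWeight G o x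

/-- The gauge is nonzero. [folklore] -/
theorem gauge_ne_zero (η : HeightSystem G o) (x : V) : η.gauge x ≠ 0 :=
  fun h => η.lower_ne_zero (le_zero_iff.1 (h ▸ η.lower_le x))

/-- The gauge is finite. [folklore] -/
theorem gauge_ne_top (η : HeightSystem G o) (x : V) : η.gauge x ≠ ⊤ :=
  ne_top_of_le_ne_top η.upper_ne_top (η.le_upper x)

/-- **(I) Along an edge the height drops by at most the factor `Δ`**: `Δ h(x) ≤ h(y)`.
[cite: Timar2006, §4 (proof of Thm. 4.3: ℓ_1 is the lowest level adjacent to o)] -/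
theorem ratio_mul_height_le (η : HeightSystem G o) {x y : V} (h : G.Adj x y) :
    η.ratio * η.height x ≤ η.height y :=
  η.ratio_mul_le h

/-- **(II) Long edges everywhere**: every vertex has a neighbour of height exactly `Δ h(x)`.
[cite: Timar2006, §4 (proof of Thm. 4.3: long edges)] -/
theorem exists_adj_height_eq (η : HeightSystem G o) (x : V) :
    ∃ y : V, G.Adj x y ∧ η.height y = η.ratio * η.height x :=
  η.exists_adj_eq x

/-- Heights and weights are comparable from below: `lower · w ≤ h`. [folklore] -/
theorem lower_mul_autWeight_le_height (η : HeightSystem G o) (x : V) :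
    η.lower * autWeight G o x ≤ η.height x :=
  mul_le_mul' (η.lower_le x) le_rfl

/-- Heights and weights are comparable from above: `h ≤ upper · w`. [folklore] -/
theorem height_le_upper_mul_autWeight (η : HeightSystem G o) (x : V) :
    η.height x ≤ η.upper * autWeight G o x :=
  mul_le_mul' (η.le_upper x) le_rfl

variable [G.LocallyFinite]

/-- Normalisation: `h(o) = 1` ("We may assume that the weight of `ℓ_0` is `1`").
[cite: Timar2006, §4 (proof of Thm. 4.3: the weight of ℓ_0 is 1)] -/
theorem height_base (η : HeightSystem G o) (hconn : G.Connected) : η.height o = 1 := by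
  rw [height, η.gauge_base, autWeight_self G hconn o, one_mul]

/-- Heights are nonzero. [folklore] -/
theorem height_ne_zero (η : HeightSystem G o) (hconn : G.Connected) (x : V) : η.height x ≠ 0 :=
  mul_ne_zero (η.gauge_ne_zero x) (autWeight_ne_zero G hconn o x)

/-- Heights are finite. [folklore] -/
theorem height_ne_top (η : HeightSystem G o) (hconn : G.Connected) (x : V) : η.height x ≠ ⊤ :=
  ENNReal.mul_ne_top (η.gauge_ne_top x) (autWeight_ne_top G hconn o x)

/-- **Automorphisms multiply all heights by one constant**: `h(γx) h(y) = h(γy) h(x)` (the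
cocycle of the weights, the gauge being invariant).
[cite: Timar2006, §5 (automorphisms act on weights by a constant factor)] -/
theorem height_map_mul (η : HeightSystem G o) (hconn : G.Connected) (γ : G ≃g G) (x y : V) :
    η.height (γ x) * η.height y = η.height (γ y) * η.height x := by
  simp only [height, η.gauge_map]
  have h := autWeight_map_mul G hconn γ o x y
  calc η.gauge x * autWeight G o (γ x) * (η.gauge y * autWeight G o y)
      = η.gauge x * η.gauge y * (autWeight G o (γ x) * autWeight G o y) := by ring
    _ = η.gauge x * η.gauge y * (autWeight G o (γ y) * autWeight G o x) := by rw [h]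
    _ = η.gauge y * autWeight G o (γ y) * (η.gauge x * autWeight G o x) := by ring

omit [G.LocallyFinite] in
/-- **Heights and weights define the same heavy sets**: `Σ_{v ∈ C} h(v) = ∞ ↔ C` is heavy
(`Σ_{v ∈ C} w(v) = ∞`). [cite: Timar2006, §2 (heavy and light clusters)] -/
theorem tsum_indicator_height_eq_top_iff (η : HeightSystem G o) (C : Set V) :
    (∑' v, C.indicator η.height v) = ⊤ ↔ IsHeavy G o C := by
  rw [IsHeavy, setWeight]
  have hlow : η.lower * ∑' v, C.indicator (autWeight G o) v ≤ ∑' v, C.indicator η.height v := by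
    rw [← ENNReal.tsum_mul_left]
    refine ENNReal.tsum_le_tsum fun v => ?_
    by_cases hv : v ∈ C
    · rw [Set.indicator_of_mem hv, Set.indicator_of_mem hv]
      exact η.lower_mul_autWeight_le_height v
    · simp [Set.indicator_of_notMem hv]
  have hup : (∑' v, C.indicator η.height v) ≤ η.upper * ∑' v, C.indicator (autWeight G o) v := by
    rw [← ENNReal.tsum_mul_left]
    refine ENNReal.tsum_le_tsum fun v => ?_
    by_cases hv : v ∈ C
    · rw [Set.indicator_of_mem hv, Set.indicator_of_mem hv]
      exact η.height_le_upper_mul_autWeight v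
    · simp [Set.indicator_of_notMem hv]
  constructor
  · intro h
    rw [h, top_le_iff, ENNReal.mul_eq_top] at hup
    rcases hup with ⟨-, h'⟩ | ⟨h', -⟩
    · exact h'
    · exact absurd h' η.upper_ne_top
  · intro h
    rw [h, ENNReal.mul_top η.lower_ne_zero, top_le_iff] at hlow
    exact hlow

end HeightSystem

/-! ### Existence: the returning-walk bound -/

section Existence

variable {G : SimpleGraph V} [G.LocallyFinite]

/-- **Every returning walk drops the log-weight by at least `μ` per step, once the short ones
do** (the "minimum cycle mean" inequality of the orbit digraph): if `μ n ≤ L(y) − L(x)` for all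
walks of length `1 ≤ n ≤ |S₀|` from `x` to a vertex `y` of its orbit, then the same holds for
returning walks of every length `m ≥ 1`. Induction on `m`: among the first `|S₀| + 1` vertices
two share an orbit (`exists_orbit_repeat`); the segment between them is a short returning walk,
and transporting the tail back by the automorphism identifying its ends leaves a shorter
returning walk, the log-weights of whose ends are shifted by one constant
(`logWeight_map_sub`). [folklore] -/
theorem returning_bound (hconn : G.Connected) (S₀ : Finset V)
    (hS₀ : ∀ v : V, ∃ γ : G ≃g G, γ v ∈ S₀) (o : V) (μ : ℝ)
    (hμ : ∀ (n : ℕ) (x y : V), 1 ≤ n → n ≤ S₀.card → y ∈ autOrbit G x → StepReach G n x y →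
      μ * n ≤ logWeight G o y - logWeight G o x) :
    ∀ (m : ℕ) (x y : V), 1 ≤ m → y ∈ autOrbit G x → StepReach G m x y →
      μ * m ≤ logWeight G o y - logWeight G o x := by
  intro m
  refine Nat.strong_induction_on m ?_
  intro m ih x y hm hy hxy
  by_cases hmN : m ≤ S₀.card
  · exact hμ m x y hm hmN hy hxy
  rw [not_le] at hmN
  obtain ⟨f, hf0, hfm, hf⟩ := hxy
  obtain ⟨i, j, hij, hjN, horb⟩ := exists_orbit_repeat S₀ hS₀ f
  have hjm : j < m := lt_of_le_of_lt hjN hmN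
  obtain ⟨γ, hγ⟩ := horb
  -- the three segments
  have seg1 : StepReach G (i - 0) (f 0) (f i) := stepReach_segment hf (Nat.zero_le i) (by omega)
  rw [Nat.sub_zero, hf0] at seg1
  have seg2 : StepReach G (j - i) (f i) (f j) := stepReach_segment hf hij.le hjm.le
  have seg3 : StepReach G (m - j) (f j) (f m) := stepReach_segment hf hjm.le le_rfl
  rw [hfm] at seg3
  -- the short returning segment
  have h2 : μ * ((j - i : ℕ) : ℝ) ≤ logWeight G o (f j) - logWeight G o (f i) :=
    hμ (j - i) (f i) (f j) (by omega) (by omega) ⟨γ, hγ⟩ seg2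
  -- transport the tail back by `γ⁻¹` and close up
  have hγi : γ.symm (f j) = f i := by rw [← hγ, γ.symm_apply_apply]
  have seg3' : StepReach G (m - j) (f i) (γ.symm y) := by
    have := seg3.map γ.symm
    rwa [hγi] at this
  have hnew : StepReach G (i + (m - j)) x (γ.symm y) := seg1.append seg3'
  have hy' : γ.symm y ∈ autOrbit G x := by
    obtain ⟨δ, rfl⟩ := hy
    exact ⟨δ.trans γ.symm, rfl⟩
  have h1 : μ * ((i + (m - j) : ℕ) : ℝ) ≤ logWeight G o (γ.symm y) - logWeight G o x :=
    ih (i + (m - j)) (by omega) x (γ.symm y) (by omega) hy' hnew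
  -- `L(γ⁻¹ y) − L(y) = L(f i) − L(f j)`
  have hshift : logWeight G o (γ.symm y) - logWeight G o y =
      logWeight G o (f i) - logWeight G o (f j) := by
    have := logWeight_map_sub G hconn γ.symm o y (f j)
    rwa [hγi] at this
  have hcast : (m : ℝ) = ((i + (m - j) : ℕ) : ℝ) + ((j - i : ℕ) : ℝ) := by
    rw [← Nat.cast_add]
    congr 1
    omega
  rw [hcast, mul_add]
  linarith

/-- The hypothesis of `returning_bound` from its version at representatives: a bound for the
short returning walks starting in `S₀` transports to all short returning walks. [folklore] -/
theorem returning_bound_base (hconn : G.Connected) (S₀ : Finset V)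
    (hS₀ : ∀ v : V, ∃ γ : G ≃g G, γ v ∈ S₀) (o : V) (μ : ℝ)
    (hμ : ∀ (n : ℕ) (x y : V), 1 ≤ n → n ≤ S₀.card → x ∈ S₀ → y ∈ autOrbit G x →
      StepReach G n x y → μ * n ≤ logWeight G o y - logWeight G o x)
    (n : ℕ) (x y : V) (hn : 1 ≤ n) (hnN : n ≤ S₀.card) (hy : y ∈ autOrbit G x)
    (hxy : StepReach G n x y) : μ * n ≤ logWeight G o y - logWeight G o x := by
  obtain ⟨δ, hδ⟩ := hS₀ x
  have h := hμ n (δ x) (δ y) hn hnN hδ (map_mem_autOrbit_map δ hy) (hxy.map δ)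
  have hshift := logWeight_map_sub G hconn δ o y x
  linarith

/-- **Shortening**: under the returning-walk bound with constant `μ`, a walk of length
`m > |S₀|` from `x` can be replaced by a strictly shorter walk from `x` to a vertex of the same
orbit as its end, without increasing the `μ`-corrected log-drop `L(z) − L(x) − μ m`. [folklore] -/
theorem exists_shorter_of_card_lt (hconn : G.Connected) (S₀ : Finset V)
    (hS₀ : ∀ v : V, ∃ γ : G ≃g G, γ v ∈ S₀) (o : V) (μ : ℝ)
    (hret : ∀ (m : ℕ) (x y : V), 1 ≤ m → y ∈ autOrbit G x → StepReach G m x y →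
      μ * m ≤ logWeight G o y - logWeight G o x)
    {m : ℕ} {x z : V} (hxz : StepReach G m x z) (hm : S₀.card < m) :
    ∃ m' : ℕ, m' < m ∧ ∃ z' : V, z' ∈ autOrbit G z ∧ StepReach G m' x z' ∧
      logWeight G o z' - logWeight G o x - μ * m' ≤ logWeight G o z - logWeight G o x - μ * m := by
  obtain ⟨f, hf0, hfm, hf⟩ := hxz
  obtain ⟨i, j, hij, hjN, horb⟩ := exists_orbit_repeat S₀ hS₀ f
  have hjm : j < m := lt_of_le_of_lt hjN hm
  obtain ⟨γ, hγ⟩ := horb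
  have seg1 : StepReach G (i - 0) (f 0) (f i) := stepReach_segment hf (Nat.zero_le i) (by omega)
  rw [Nat.sub_zero, hf0] at seg1
  have seg2 : StepReach G (j - i) (f i) (f j) := stepReach_segment hf hij.le hjm.le
  have seg3 : StepReach G (m - j) (f j) (f m) := stepReach_segment hf hjm.le le_rfl
  rw [hfm] at seg3
  have h2 : μ * ((j - i : ℕ) : ℝ) ≤ logWeight G o (f j) - logWeight G o (f i) :=
    hret (j - i) (f i) (f j) (by omega) ⟨γ, hγ⟩ seg2
  have hγi : γ.symm (f j) = f i := by rw [← hγ, γ.symm_apply_apply]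
  have seg3' : StepReach G (m - j) (f i) (γ.symm z) := by
    have := seg3.map γ.symm
    rwa [hγi] at this
  refine ⟨i + (m - j), by omega, γ.symm z, ⟨γ.symm, rfl⟩, seg1.append seg3', ?_⟩
  have hshift : logWeight G o (γ.symm z) - logWeight G o z =
      logWeight G o (f i) - logWeight G o (f j) := by
    have := logWeight_map_sub G hconn γ.symm o z (f j)
    rwa [hγi] at this
  have hcast : (m : ℝ) = ((i + (m - j) : ℕ) : ℝ) + ((j - i : ℕ) : ℝ) := by
    rw [← Nat.cast_add]
    congr 1
    omega
  rw [hcast, mul_add]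
  linarith

/-- Iterated shortening: every walk from `x` ending in the orbit of `x₀` can be replaced by one of
length `≤ N'` (any `N' ≥ |S₀|`) from `x` into the orbit of `x₀`, without increasing the
`μ`-corrected log-drop. [folklore] -/
theorem exists_short_of_stepReach (hconn : G.Connected) (S₀ : Finset V)
    (hS₀ : ∀ v : V, ∃ γ : G ≃g G, γ v ∈ S₀) (o : V) (μ : ℝ)
    (hret : ∀ (m : ℕ) (x y : V), 1 ≤ m → y ∈ autOrbit G x → StepReach G m x y →
      μ * m ≤ logWeight G o y - logWeight G o x)
    {N' : ℕ} (hN' : S₀.card ≤ N') (x₀ : V) :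
    ∀ (m : ℕ) (x z : V), z ∈ autOrbit G x₀ → StepReach G m x z →
      ∃ m' : ℕ, m' ≤ N' ∧ ∃ z' : V, z' ∈ autOrbit G x₀ ∧ StepReach G m' x z' ∧
        logWeight G o z' - logWeight G o x - μ * m' ≤
          logWeight G o z - logWeight G o x - μ * m := by
  intro m
  refine Nat.strong_induction_on m ?_
  intro m ih x z hz hxz
  by_cases hm : m ≤ N'
  · exact ⟨m, hm, z, hz, hxz, le_rfl⟩
  · obtain ⟨m', hm', z', hz', hxz', hle⟩ :=
      exists_shorter_of_card_lt hconn S₀ hS₀ o μ hret hxz (by omega)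
    obtain ⟨m'', hm'', z'', hz'', hxz'', hle'⟩ := ih m' hm' x z' (mem_autOrbit_trans hz hz') hxz'
    exact ⟨m'', hm'', z'', hz'', hxz'', hle'.trans hle⟩

/-- **Existence of a height system on a connected, locally finite, quasi-transitive,
nonunimodular graph** (see the module docstring for the construction: the min-plus eigenvector
of the orbit digraph). [cite: Timar2006, §4 (proof of Thm. 4.3: ℓ_1, long edges, Δ — transitive case)]
[cite: Hutchcroft2016, §2 (Timár's theorem for quasi-transitive graphs)] -/
theorem exists_heightSystem (hconn : G.Connected) (hqt : IsQuasiTransitive G)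
    (hU : ¬ IsGraphUnimodular G) (o : V) : Nonempty (HeightSystem G o) := by
  classical
  obtain ⟨S₀, hS₀⟩ := hqt
  set N := S₀.card with hN
  /- Step 1: the finite nonempty set of mean log-drops of short returning walks from `S₀`,
     and its minimum `μ`. -/
  set T : Set ℝ := {q | ∃ (n : ℕ) (x y : V), 1 ≤ n ∧ n ≤ N ∧ x ∈ S₀ ∧ y ∈ autOrbit G x ∧
    StepReach G n x y ∧ q = (logWeight G o y - logWeight G o x) / n} with hT
  have hTfin : T.Finite := by
    have hP : {p : ℕ × V × V | p.1 ≤ N ∧ p.2.1 ∈ S₀ ∧ p.2.2 ∈ graphBall G p.2.1 N}.Finite := by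
      refine Set.Finite.subset ((Set.finite_Iic N).prod ((S₀.finite_toSet).prod
        (Set.Finite.biUnion S₀.finite_toSet fun x _ => graphBall_finite G x N))) ?_
      rintro ⟨n, x, y⟩ ⟨hn, hx, hy⟩
      exact ⟨hn, hx, Set.mem_biUnion hx hy⟩
    refine (hP.image fun p : ℕ × V × V =>
      (logWeight G o p.2.2 - logWeight G o p.2.1) / p.1).subset ?_
    rintro q ⟨n, x, y, -, hnN, hx, -, hxy, rfl⟩
    exact ⟨⟨n, x, y⟩, ⟨hnN, hx, graphBall_mono G x hnN hxy.mem_graphBall⟩, rfl⟩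
  -- a nonunimodular pair in a common orbit, `L b < L a`, and a walk between them
  obtain ⟨a, b, hab, hLab⟩ : ∃ a b : V, b ∈ autOrbit G a ∧ logWeight G o b < logWeight G o a := by
    obtain ⟨x, y, hxy, habove⟩ := exists_isAbove_of_not_isGraphUnimodular hU
    rw [isAbove_iff_autWeight_lt G hconn o] at habove
    exact ⟨x, y, hxy, (logWeight_lt_logWeight_iff G hconn o x y).2 habove⟩
  obtain ⟨m₀, hm₀⟩ := exists_stepReach_of_connected hconn a b
  have hm₀1 : 1 ≤ m₀ := by
    rcases Nat.eq_zero_or_pos m₀ with rfl | h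
    · exact absurd (hm₀.eq_of_zero ▸ hLab) (lt_irrefl _)
    · exact h
  -- `T` is nonempty: a returning segment of the walk from `a` to `b` (or the walk itself)
  have hTne : T.Nonempty := by
    suffices h : ∃ (n : ℕ) (x y : V), 1 ≤ n ∧ n ≤ N ∧ y ∈ autOrbit G x ∧ StepReach G n x y by
      obtain ⟨n, x, y, hn1, hnN, hy, hxy⟩ := h
      obtain ⟨δ, hδ⟩ := hS₀ x
      exact ⟨_, n, δ x, δ y, hn1, hnN, hδ, map_mem_autOrbit_map δ hy, hxy.map δ, rfl⟩
    by_cases hmN : m₀ ≤ N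
    · exact ⟨m₀, a, b, hm₀1, hmN, hab, hm₀⟩
    · obtain ⟨f, -, -, hf⟩ := hm₀
      obtain ⟨i, j, hij, hjN, horb⟩ := exists_orbit_repeat S₀ hS₀ f
      exact ⟨j - i, f i, f j, by omega, by omega, horb, stepReach_segment hf hij.le (by omega)⟩
  set μ : ℝ := sInf T with hμdef
  have hμmem : μ ∈ T := hTne.csInf_mem hTfin
  have hμle : ∀ q ∈ T, μ ≤ q := fun q hq => csInf_le hTfin.bddBelow hq
  /- Step 2: the returning-walk bound for all lengths. -/
  have hbase : ∀ (n : ℕ) (x y : V), 1 ≤ n → n ≤ S₀.card → x ∈ S₀ → y ∈ autOrbit G x →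
      StepReach G n x y → μ * n ≤ logWeight G o y - logWeight G o x := by
    intro n x y hn hnN hx hy hxy
    have hq : (logWeight G o y - logWeight G o x) / n ∈ T := ⟨n, x, y, hn, hnN, hx, hy, hxy, rfl⟩
    have hnpos : (0 : ℝ) < n := by exact_mod_cast hn
    have := hμle _ hq
    rwa [le_div_iff₀ hnpos] at this
  have hret : ∀ (m : ℕ) (x y : V), 1 ≤ m → y ∈ autOrbit G x → StepReach G m x y →
      μ * m ≤ logWeight G o y - logWeight G o x :=
    returning_bound hconn S₀ hS₀ o μ (returning_bound_base hconn S₀ hS₀ o μ hbase)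
  /- Step 3: `μ < 0`. -/
  have hμneg : μ < 0 := by
    have h := hret m₀ a b hm₀1 hab hm₀
    have hm₀pos : (0 : ℝ) < m₀ := by exact_mod_cast hm₀1
    by_contra hμ0
    rw [not_lt] at hμ0
    have : 0 ≤ μ * m₀ := mul_nonneg hμ0 hm₀pos.le
    linarith
  /- Step 4: a minimiser: a returning walk of length `n₀ ≥ 1` from `x₀` with mean exactly `μ`. -/
  obtain ⟨n₀, x₀, y₀, hn₀1, -, -, hy₀, hx₀y₀, hμeq⟩ := hμmem
  have hn₀pos : (0 : ℝ) < n₀ := by exact_mod_cast hn₀1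
  have hcrit : logWeight G o y₀ - logWeight G o x₀ = μ * n₀ := by
    rw [hμeq, div_mul_cancel₀ _ hn₀pos.ne']
  /- Step 5: the potential `φ`. Every vertex reaches the orbit of `x₀` in `≤ D₀` steps. -/
  choose δ hδ using hS₀
  have hwalk : ∀ s : V, ∃ d : ℕ, StepReach G d s x₀ :=
    fun s => exists_stepReach_of_connected hconn s x₀
  choose dist hdist using hwalk
  set D₀ : ℕ := S₀.sup dist with hD₀
  set N' : ℕ := max N D₀ with hN'
  have hNN' : S₀.card ≤ N' := le_max_left _ _
  -- the candidate values at `x`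
  set Φ : V → Set ℝ := fun x => {r | ∃ (n : ℕ) (z : V), n ≤ N' ∧ z ∈ autOrbit G x₀ ∧
    StepReach G n x z ∧ r = logWeight G o z - logWeight G o x - μ * n} with hΦ
  have hΦfin : ∀ x, (Φ x).Finite := by
    intro x
    have hP : {p : ℕ × V | p.1 ≤ N' ∧ p.2 ∈ graphBall G x N'}.Finite :=
      ((Set.finite_Iic N').prod (graphBall_finite G x N')).subset fun p hp => ⟨hp.1, hp.2⟩
    refine (hP.image fun p : ℕ × V => logWeight G o p.2 - logWeight G o x - μ * p.1).subset ?_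
    rintro r ⟨n, z, hn, -, hxz, rfl⟩
    exact ⟨⟨n, z⟩, ⟨hn, graphBall_mono G x hn hxz.mem_graphBall⟩, rfl⟩
  have hΦne : ∀ x, (Φ x).Nonempty := by
    intro x
    -- `δ x x ∈ S₀` reaches `x₀` in `dist (δ x x) ≤ D₀` steps; transport back by `(δ x)⁻¹`
    have h1 : StepReach G (dist (δ x x)) x ((δ x).symm x₀) := by
      have := (hdist (δ x x)).map (δ x).symm
      rwa [RelIso.symm_apply_apply] at this
    have h2 : dist (δ x x) ≤ N' :=
      (Finset.le_sup (f := dist) (hδ x)).trans (le_max_right _ _)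
    exact ⟨_, dist (δ x x), (δ x).symm x₀, h2, ⟨(δ x).symm, rfl⟩, h1, rfl⟩
  set φ : V → ℝ := fun x => sInf (Φ x) with hφ
  have hφmem : ∀ x, φ x ∈ Φ x := fun x => (hΦne x).csInf_mem (hΦfin x)
  have hφle : ∀ x, ∀ r ∈ Φ x, φ x ≤ r := fun x r hr => csInf_le (hΦfin x).bddBelow hr
  -- any walk from `x` into the orbit of `x₀` bounds `φ x` (after shortening)
  have hφle' : ∀ (x : V) (m : ℕ) (z : V), z ∈ autOrbit G x₀ → StepReach G m x z →
      φ x ≤ logWeight G o z - logWeight G o x - μ * m := by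
    intro x m z hz hxz
    obtain ⟨m', hm', z', hz', hxz', hle⟩ :=
      exists_short_of_stepReach hconn S₀ (fun v => ⟨δ v, hδ v⟩) o μ hret hNN' x₀ m x z hz hxz
    exact (hφle x _ ⟨m', z', hm', hz', hxz', rfl⟩).trans hle
  -- (i) the edge inequality
  have hedge : ∀ x y : V, G.Adj x y →
      φ x ≤ logWeight G o y - logWeight G o x - μ + φ y := by
    intro x y hxy
    obtain ⟨n, z, -, hz, hyz, hφy⟩ := hφmem y
    have h := hφle' x (n + 1) z hz (hyz.cons hxy)
    rw [hφy]
    push_cast at h ⊢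
    linarith
  -- (ii) a tight edge at every vertex
  have htight : ∀ x : V, ∃ y : V, G.Adj x y ∧
      logWeight G o y - logWeight G o x - μ + φ y ≤ φ x := by
    intro x
    obtain ⟨n, z, hn, hz, hxz, hφx⟩ := hφmem x
    rcases n with _ | n
    · -- `x` is in the orbit of `x₀`: use the transported critical walk
      have hxz0 : x = z := hxz.eq_of_zero
      subst hxz0
      obtain ⟨γ, rfl⟩ := hz
      have hcw : StepReach G n₀ (γ x₀) (γ y₀) := hx₀y₀.map γ
      obtain ⟨n₁, rfl⟩ : ∃ n₁, n₀ = n₁ + 1 := ⟨n₀ - 1, by omega⟩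
      obtain ⟨y, hxy, hyz⟩ := hcw.uncons
      refine ⟨y, hxy, ?_⟩
      have hγy₀ : γ y₀ ∈ autOrbit G x₀ := (map_mem_autOrbit_iff γ).2 hy₀
      have h1 := hφle' y n₁ (γ y₀) hγy₀ hyz
      have hshift := logWeight_map_sub G hconn γ o y₀ x₀
      rw [hφx]
      push_cast at hcrit h1 ⊢
      linarith
    · obtain ⟨y, hxy, hyz⟩ := hxz.uncons
      refine ⟨y, hxy, ?_⟩
      have h1 := hφle y _ ⟨n, z, (Nat.le_succ n).trans hn, hz, hyz, rfl⟩
      rw [hφx]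
      push_cast at h1 ⊢
      linarith
  -- (iii) invariance of `φ`
  have hΦmap : ∀ (γ : G ≃g G) (x : V), Φ (γ x) ⊆ Φ x := by
    rintro γ x r ⟨n, z, hn, hz, hxz, rfl⟩
    refine ⟨n, γ.symm z, hn, (map_mem_autOrbit_iff γ.symm).2 hz, ?_, ?_⟩
    · have := hxz.map γ.symm
      rwa [γ.symm_apply_apply] at this
    · have hshift := logWeight_map_sub G hconn γ.symm o z (γ x)
      rw [γ.symm_apply_apply] at hshift
      linarith
  have hφmap : ∀ (γ : G ≃g G) (x : V), φ (γ x) = φ x := by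
    intro γ x
    apply le_antisymm
    · refine hφle _ _ ?_
      have h := hΦmap γ.symm (γ x)
      rw [γ.symm_apply_apply] at h
      exact h (hφmem x)
    · exact hφle _ _ (hΦmap γ x (hφmem (γ x)))
  -- (iv) `φ` takes its values among finitely many
  have hφval : ∀ x, φ x ∈ S₀.image φ := fun x =>
    Finset.mem_image.2 ⟨δ x x, hδ x, hφmap (δ x) x⟩
  have himne : (S₀.image φ).Nonempty := ⟨φ o, hφval o⟩
  set φmin : ℝ := (S₀.image φ).min' himne with hφmin
  set φmax : ℝ := (S₀.image φ).max' himne with hφmax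
  have hφmin_le : ∀ x, φmin ≤ φ x := fun x => Finset.min'_le _ _ (hφval x)
  have hle_φmax : ∀ x, φ x ≤ φmax := fun x => Finset.le_max' _ _ (hφval x)
  /- Step 6: exponentiate. -/
  have hLw : ∀ x, autWeight G o x = ENNReal.ofReal (Real.exp (logWeight G o x)) :=
    autWeight_eq_ofReal_exp_logWeight G hconn o
  -- normalise the potential at the base vertex: `ψ := φ − φ(o)`
  set ψ : V → ℝ := fun x => φ x - φ o with hψ
  have hheight : ∀ x, ENNReal.ofReal (Real.exp (ψ x)) * autWeight G o x =
      ENNReal.ofReal (Real.exp (ψ x + logWeight G o x)) := by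
    intro x
    rw [hLw x, ← ENNReal.ofReal_mul (Real.exp_pos _).le, Real.exp_add]
  refine ⟨{ gauge := fun x => ENNReal.ofReal (Real.exp (ψ x)),
             ratio := ENNReal.ofReal (Real.exp μ),
             lower := ENNReal.ofReal (Real.exp (φmin - φ o)),
             upper := ENNReal.ofReal (Real.exp (φmax - φ o)),
             gauge_map := fun γ x => by simp only [hψ, hφmap],
             gauge_base := by simp [hψ],
             lower_ne_zero := (ENNReal.ofReal_pos.2 (Real.exp_pos _)).ne',
             upper_ne_top := ENNReal.ofReal_ne_top,
             lower_le := fun x => ENNReal.ofReal_le_ofReal (Real.exp_le_exp.2 (by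
               simp only [hψ]; linarith [hφmin_le x])),
             le_upper := fun x => ENNReal.ofReal_le_ofReal (Real.exp_le_exp.2 (by
               simp only [hψ]; linarith [hle_φmax x])),
             ratio_ne_zero := (ENNReal.ofReal_pos.2 (Real.exp_pos _)).ne',
             ratio_lt_one := ?_,
             ratio_mul_le := ?_,
             exists_adj_eq := ?_ }⟩
  · rw [← ENNReal.ofReal_one]
    exact (ENNReal.ofReal_lt_ofReal_iff_of_nonneg (Real.exp_pos _).le).2
      (Real.exp_lt_one_iff.2 hμneg)
  · intro x y hxy
    show ENNReal.ofReal (Real.exp μ) * (ENNReal.ofReal (Real.exp (ψ x)) * autWeight G o x) ≤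
      ENNReal.ofReal (Real.exp (ψ y)) * autWeight G o y
    rw [hheight x, hheight y, ← ENNReal.ofReal_mul (Real.exp_pos _).le, ← Real.exp_add]
    refine ENNReal.ofReal_le_ofReal (Real.exp_le_exp.2 ?_)
    have := hedge x y hxy
    simp only [hψ]
    linarith
  · intro x
    obtain ⟨y, hxy, hle⟩ := htight x
    refine ⟨y, hxy, ?_⟩
    show ENNReal.ofReal (Real.exp (ψ y)) * autWeight G o y =
      ENNReal.ofReal (Real.exp μ) * (ENNReal.ofReal (Real.exp (ψ x)) * autWeight G o x)
    rw [hheight x, hheight y, ← ENNReal.ofReal_mul (Real.exp_pos _).le, ← Real.exp_add]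
    have := hedge x y hxy
    have heq : ψ y + logWeight G o y = μ + (ψ x + logWeight G o x) := by
      simp only [hψ]
      linarith
    rw [heq]

end Existence

end Literature.Barriers.CriticalPhenomena

end
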